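import Literature.NumberTheory.Automorphic.IdeleClassCharacterCMTypeComponents
import HarnessLib

/-!
# [Liu 2021] Thm. 4.18's datum at the toy `E = ℚ(ζ₉)`: the CM type `(D …).cmType` of a `Thm418Data` read off `D.μ`'s archimedean components

Y. Liu, *Fourier–Jacobi cycles and arithmetic relative trace formula*, Camb. J. Math. **9** (2021) = arXiv:2102.11518 [Liu2021], TeX source
`FJcycle.tex` §4.1 l. 1908–1912 (the paragraph following Rem. 4.2; held extraction `paper:arxiv-2102.11518` p0018 L31–L35) and Def. 4.3
(l. 1914–1921); [Shimura1998] §8.4 Example (1); [WeilBNT1967] Ch. VII §3; [Washington1997] Thm. 2.5.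

AS PRINTED (l. 1908–1912): «For a conjugate symplectic (resp. conjugate orthogonal) automorphic character `μ`, there exist a CM type `Φ_μ` and
a unique tuple `𝚠_μ = (𝚠_τ)_{τ ∈ Φ_F}` of odd (resp. even) nonnegative integers such that for every `τ ∈ Φ_F`, the component
`μ_τ : (E ⊗_{F,τ} ℝ)^× → ℂ^×` is the character `z ↦ arg(z)^{−𝚠_τ}`, where we have identified `(E ⊗_{F,τ} ℝ)^×` with `ℂ^×` via the unique
element `τ' ∈ Φ_μ` above `τ`. If `𝚠_μ` does not contain `0`, then `Φ_μ` is also unique.»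

PURPOSE (pub-hodgecm2 red team, `hodge-director/TGTBT.md` DELTA 15, 2026-08-22T00:32:22Z, D15.3 item 3, verbatim): «(row 81) D14.3 item 5
ι-side: run the ℚ(ζ₉) toy through `mem_cmType_iff_apply_singleUnits` at the displays' `hμ` binder; a mismatch with Liu ll. 1908–1915 is the
cheapest falsifier still standing.»  The S2 displays' binder is
`hμ : ∀ (F : CMField), IsGalois ℚ F → 6 ≤ finrank ℚ F → ∀ Φ ι₁, ι₁ ∈ Φ.1 → ∀ V (g : F ≃ₐ[ℚ] F), ι₁ ∘ g ∈ (D F ι₁ V Φ).cmType.1 ↔ ι₁ ∘ g⁻¹ ∈ Φ.1`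
with `D F ι₁ V Φ : Thm418Data (maximalRealSubfield F) F` (`Transposition/Item6SupplyPinnedDef45Reading.lean` :88–90; END display
`Item6SupplyPinnedAssemblyAlongHolds.lean` with `D := toThm418Data (C …) (R …)`).  Its `ℚ(ζ₉)`-slice quantifies over EXACTLY the objects of
this file: a CM number field `L` with `IsCyclotomicExtension {9} ℚ L` (Galois, degree `6` — the binder's guards, `isGalois_nine`,
`finrank_nine`), `ι : L →+* ℂ`, a CM type `Φ`, and a datum `D : Thm418Data (maximalRealSubfield L) L` (the hermitian space `V` only
indexes the datum).  The companion file `IdeleClassCharacterCMTypeComponents` (p310699) ran the toy at the level of a bare character `μ`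
(`hμ.cmType`); THIS file runs it at the level of the displays' datum TYPE, `(D …).cmType` with `D : Thm418Data L⁺ L` — theorems only,
0 `def`, 0 named fact, axioms `[propext, Classical.choice, Quot.sound]`:

* `Thm418Data.cmType_eq_cmType`: `D.cmType = D.isConjugateSymplectic.cmType` at the ambient `IsCMField L` instance (`rfl`: the instance
  inside `Thm418Data.cmType`, `Liu2021.isCMField L⁺ L`, and the ambient one prove the same `Prop`).
* THE RUN.  Hypothesis `hD : ∀ g, ι ∘ g ∈ D.cmType.1 ↔ a(g) ∈ {1,2,4}` (`g ζ₉ = ζ₉^{a(g)}`; the toy type of p308157 / p309404 / p310699, now on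
  the datum).  `Thm418Data.apply_singleUnits_nine_of_mem`: for `a(g) ∈ {1,2,4}` (`τ' = ι ∘ g ∈ Φ_μ`), at the place `w` of `τ'` with `L_w ≅ ℂ`
  via the continuous extension `φ̂` of `τ'`: **`D.μ[c] = arg(φ̂ c)⁻¹`**; `Thm418Data.apply_singleUnits_nine_of_not_mem` / `…_of_mem_conj`:
  for `a(g) ∉ {1,2,4}` / `a(g) ∈ {5,7,8}` (the conjugates `τ̄'`): **`D.μ[c] = arg(φ̂ c)`**.  PRINT with `𝚠_μ = 1` (the datum's `hasWeight_one`): `arg^{−1}` through `τ' ∈ Φ_μ`; the same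
  component through `τ̄' = conj ∘ τ'` is `z ↦ arg(z̄)⁻¹ = arg(z)^{+1}`.  MATCH at all six complex embeddings (three places × two
  identifications) — the falsifier does not fire.
* THE BINDER'S SLICE, evaluated: `Thm418Data.display_hmu_nine_iff`: `(∀ g, ι ∘ g ∈ D.cmType.1 ↔ ι ∘ g⁻¹ ∈ Φ.1) ↔ (Φ ↔ {1,5,7} = {1,2,4}⁻¹)`
  (the reflex type, [Shimura1998] §8.4 (1)); then `ι ∈ Φ.1` (`…self_mem…`, the guard `ι₁ ∈ Φ.1` is consistent) and `Φ ≠ Φ_μ` (`σ₂`,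
  `…exists_mem_cmType_not_mem…`).
* NON-VACUITY at the datum type: `Thm418Data.exists_cmType_nine`: for every `ι` there IS `D : Thm418Data L⁺ L` with `hD` (REAL fields = a
  weight-one conjugate symplectic `μ` with `Φ_μ ↔ {1,2,4}`, [WeilBNT1967] VII §3 via the tree; carriers trivial as in `Thm418Data.nonempty`);
  and the hypotheses on `L` are met by Mathlib's `CyclotomicField 9 ℚ` (`isCyclotomicExtension_cyclotomicField_nine`,
  `isCMField_cyclotomicField_nine`).

A Summit-side probe with the LITERAL binder (token-checked against the display theorems) is kept by the pub-hodgecm2 cell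
(`pinning/hcomp/hcomp-abcm-2/D15Item3DisplayBinderToyRun.lean`); this file is its Literature content.

## References
* [Liu2021] Y. Liu, Camb. J. Math. 9 (2021) = arXiv:2102.11518 — §4.1 l. 1908–1912 (paragraph following Rem. 4.2), Def. 4.3 (l. 1914–1921),
  Def. 4.16 / Thm. 4.18 (l. 2219, 2232–2245).
* [Shimura1998] G. Shimura, *Abelian Varieties with Complex Multiplication and Modular Functions*, Princeton 1998 — §8.4 Example (1).
* [WeilBNT1967] A. Weil, *Basic Number Theory*, Springer 1967 — Ch. VII §3.
* [Washington1997] L. C. Washington, *Introduction to Cyclotomic Fields*, 2nd ed., GTM 83, Springer 1997 — Thm. 2.5 (`[ℚ(ζ_n):ℚ] = φ(n)`,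
  `Gal(ℚ(ζ_n)/ℚ) ≅ (ℤ/n)^×`).

Provenance: pub-hodgecm2 TEAM hComp seat `hcomp-abcm-2` gen 7, 2026-08-22, answering `hodge-director/TGTBT.md` D15.3 item 3.
HC_CM is NOT proved; count-neutral.
-/

set_option autoImplicit false

noncomputable section

open NumberField NumberField.InfinitePlace NumberField.ComplexEmbedding
open Literature.AlgebraicGeometry.Motives (CMType)

namespace Literature.NumberTheory.Automorphic.Liu2021

open IdeleClassGroup InfiniteAdeleRing Literature.Analysis.Complex

/-! ## §1 The guards of the displays' binder at `ℚ(ζ₉)` -/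

section Nine

variable (L : Type) [Field L] [NumberField L] [IsCMField L] [IsCyclotomicExtension {9} ℚ L]

omit [IsCMField L] in
/-- `ℚ(ζ₉)/ℚ` is Galois (the binder's guard `IsGalois ℚ F`; Mathlib `IsCyclotomicExtension.isGalois`). [cite: Washington1997, Thm. 2.5] -/
theorem isGalois_nine : IsGalois ℚ L := IsCyclotomicExtension.isGalois ({9} : Set ℕ) ℚ L

omit [IsCMField L] in
/-- `[ℚ(ζ₉) : ℚ] = φ(9) = 6` (the binder's guard `6 ≤ finrank ℚ F`; Mathlib `IsCyclotomicExtension.finrank`). [cite: Washington1997, Thm. 2.5] -/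
theorem finrank_nine : Module.finrank ℚ L = 6 := by
  rw [IsCyclotomicExtension.finrank (n := 9) (K := ℚ) L (Polynomial.cyclotomic.irreducible_rat (by norm_num))]
  decide

/-! ## §2 The run on a datum `D : Thm418Data L⁺ L` -/

variable {L}
variable (D : Thm418Data (maximalRealSubfield L) L)

omit [IsCyclotomicExtension {9} ℚ L] in
/-- `(D …).cmType` IS the tree's `Φ_μ` of the datum's REAL field `μ` at the ambient `IsCMField L` instance: `Thm418Data.cmType` unfolds to
`IsConjugateSymplectic.cmType`, and the instance it uses (`Liu2021.isCMField L⁺ L`) proves the same `Prop` as the ambient one.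
[cite: Liu2021, Def. 4.3 (2)] -/
theorem Thm418Data.cmType_eq_cmType :
    D.cmType = (show IsConjugateSymplectic L D.μ from D.isConjugateSymplectic).cmType := rfl

omit [IsCyclotomicExtension {9} ℚ L] in
/-- The datum's `μ` has weight one at the ambient instance (its field `hasWeight_one`). [cite: Liu2021, Def. 4.16] -/
theorem Thm418Data.hasWeight_one' : HasWeight L D.μ 1 := D.hasWeight_one

/-- **RUN, through `σ₁, σ₂, σ₄`.**  If the datum has `Φ_μ ↔ a(g) ∈ {1,2,4}` through `ι`, then for `a(g) ∈ {1,2,4}` — `τ' := ι ∘ g ∈ D.cmType`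
— the `w`-component of `D.μ` (`w` the place of `τ'`), with `L_w ≅ ℂ` via the continuous extension `φ̂` of `τ'`, is `z ↦ arg(z)⁻¹`.
PRINT, `𝚠_τ = 1`: «`z ↦ arg(z)^{−𝚠_τ}` … via the unique element `τ' ∈ Φ_μ` above `τ`».  MATCH.
[cite: Liu2021, §4.1 l. 1908–1912 (paragraph following Rem. 4.2) and Def. 4.3] -/
theorem Thm418Data.apply_singleUnits_nine_of_mem (ι : L →+* ℂ)
    (hD : ∀ g : L ≃ₐ[ℚ] L,
      ι.comp (g : L →+* L) ∈ D.cmType.1 ↔ ((IsCyclotomicExtension.zeta_spec 9 ℚ L).autToPow ℚ g : ZMod 9) ∈ ({1, 2, 4} : Finset (ZMod 9)))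
    (g : L ≃ₐ[ℚ] L) (hg : ((IsCyclotomicExtension.zeta_spec 9 ℚ L).autToPow ℚ g : ZMod 9) ∈ ({1, 2, 4} : Finset (ZMod 9)))
    (φhat : (InfinitePlace.mk (ι.comp (g : L →+* L))).Completion →+* ℂ) (hc : Continuous φhat)
    (hext : ∀ x : L, φhat x = ι (g x)) (c : ((InfinitePlace.mk (ι.comp (g : L →+* L))).Completion)ˣ) :
    D.μ (infUnitsToClass L (singleUnits L (InfinitePlace.mk (ι.comp (g : L →+* L))) c)) =
      (unitPart (Units.map φhat.toMonoidHom c))⁻¹ :=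
  ((D.mem_cmType_iff_apply_singleUnits _ rfl φhat hc (fun x => hext x)).1 ((hD g).2 hg)) c

/-- **RUN, through `σ₅, σ₇, σ₈`** (`a(g) ∉ {1,2,4}`, the conjugates `τ̄'` of the elements of `Φ_μ`): the same components read `z ↦ arg(z)^{+1}`.
PRINT: identified with `arg^{−1}` «via `τ' ∈ Φ_μ`»; through `τ̄' = conj ∘ τ'` that is `z ↦ arg(z̄)⁻¹ = arg(z)`.  MATCH.
[cite: Liu2021, §4.1 l. 1908–1912 (paragraph following Rem. 4.2) and Def. 4.3] -/
theorem Thm418Data.apply_singleUnits_nine_of_not_mem (ι : L →+* ℂ)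
    (hD : ∀ g : L ≃ₐ[ℚ] L,
      ι.comp (g : L →+* L) ∈ D.cmType.1 ↔ ((IsCyclotomicExtension.zeta_spec 9 ℚ L).autToPow ℚ g : ZMod 9) ∈ ({1, 2, 4} : Finset (ZMod 9)))
    (g : L ≃ₐ[ℚ] L) (hg : ((IsCyclotomicExtension.zeta_spec 9 ℚ L).autToPow ℚ g : ZMod 9) ∉ ({1, 2, 4} : Finset (ZMod 9)))
    (φhat : (InfinitePlace.mk (ι.comp (g : L →+* L))).Completion →+* ℂ) (hc : Continuous φhat)
    (hext : ∀ x : L, φhat x = ι (g x)) (c : ((InfinitePlace.mk (ι.comp (g : L →+* L))).Completion)ˣ) :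
    D.μ (infUnitsToClass L (singleUnits L (InfinitePlace.mk (ι.comp (g : L →+* L))) c)) =
      unitPart (Units.map φhat.toMonoidHom c) :=
  IdeleClassGroup.apply_singleUnits_nine_of_not_mem L ι D.isConjugateSymplectic D.hasWeight_one'
    (fun g => by rw [← D.cmType_eq_cmType]; exact hD g) g hg φhat hc hext c

omit [Field L] [NumberField L] [IsCMField L] [IsCyclotomicExtension {9} ℚ L] in
/-- `(ℤ/9)ˣ ∖ {1,2,4} = {5,7,8}`. [folklore] -/
private theorem coe_not_mem_of_mem_nine (u : (ZMod 9)ˣ) (hu : (u : ZMod 9) ∈ ({5, 7, 8} : Finset (ZMod 9))) :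
    (u : ZMod 9) ∉ ({1, 2, 4} : Finset (ZMod 9)) := by
  revert hu; revert u; decide

/-- **RUN, through `σ₅, σ₇, σ₈`, stated with `a(g) ∈ {5,7,8}`** (`= (ℤ/9)ˣ ∖ {1,2,4}`): `D.μ[c] = arg(φ̂ c)`.
[cite: Liu2021, §4.1 l. 1908–1912 (paragraph following Rem. 4.2) and Def. 4.3] -/
theorem Thm418Data.apply_singleUnits_nine_of_mem_conj (ι : L →+* ℂ)
    (hD : ∀ g : L ≃ₐ[ℚ] L,
      ι.comp (g : L →+* L) ∈ D.cmType.1 ↔ ((IsCyclotomicExtension.zeta_spec 9 ℚ L).autToPow ℚ g : ZMod 9) ∈ ({1, 2, 4} : Finset (ZMod 9)))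
    (g : L ≃ₐ[ℚ] L) (hg : ((IsCyclotomicExtension.zeta_spec 9 ℚ L).autToPow ℚ g : ZMod 9) ∈ ({5, 7, 8} : Finset (ZMod 9)))
    (φhat : (InfinitePlace.mk (ι.comp (g : L →+* L))).Completion →+* ℂ) (hc : Continuous φhat)
    (hext : ∀ x : L, φhat x = ι (g x)) (c : ((InfinitePlace.mk (ι.comp (g : L →+* L))).Completion)ˣ) :
    D.μ (infUnitsToClass L (singleUnits L (InfinitePlace.mk (ι.comp (g : L →+* L))) c)) =
      unitPart (Units.map φhat.toMonoidHom c) :=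
  D.apply_singleUnits_nine_of_not_mem ι hD g (coe_not_mem_of_mem_nine _ hg) φhat hc hext c

/-- **THE BINDER'S SLICE, EVALUATED.**  For a datum with `Φ_μ ↔ {1,2,4}` through `ι`, the displays' `hμ` at `(L, Φ, ι, V)` —
`∀ g, ι ∘ g ∈ (D …).cmType ↔ ι ∘ g⁻¹ ∈ Φ` — holds IFF `Φ ↔ {1,5,7} = {1,2,4}⁻¹` through `ι` (the reflex type of `Φ_μ`, p308157).
[cite: Shimura1998, §8.4 Example (1)] -/
theorem Thm418Data.display_hmu_nine_iff (ι : L →+* ℂ)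
    (hD : ∀ g : L ≃ₐ[ℚ] L,
      ι.comp (g : L →+* L) ∈ D.cmType.1 ↔ ((IsCyclotomicExtension.zeta_spec 9 ℚ L).autToPow ℚ g : ZMod 9) ∈ ({1, 2, 4} : Finset (ZMod 9)))
    (Φ : CMType L) :
    (∀ g : L ≃ₐ[ℚ] L, ι.comp (g : L →+* L) ∈ D.cmType.1 ↔ ι.comp (g.symm : L →+* L) ∈ Φ.1) ↔
      ∀ g : L ≃ₐ[ℚ] L,
        ι.comp (g : L →+* L) ∈ Φ.1 ↔ ((IsCyclotomicExtension.zeta_spec 9 ℚ L).autToPow ℚ g : ZMod 9) ∈ ({1, 5, 7} : Finset (ZMod 9)) := by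
  rw [D.cmType_eq_cmType]
  exact IdeleClassGroup.display_hmu_nine_iff L ι D.isConjugateSymplectic (fun g => by rw [← D.cmType_eq_cmType]; exact hD g) Φ

/-- … then `ι ∈ Φ` (`a(1) = 1`): the binder's guard `ι₁ ∈ Φ.1` is CONSISTENT with its body at the toy. [cite: Shimura1998, §8.4 Example (1)] -/
theorem Thm418Data.self_mem_of_display_hmu_nine (ι : L →+* ℂ)
    (hD : ∀ g : L ≃ₐ[ℚ] L,
      ι.comp (g : L →+* L) ∈ D.cmType.1 ↔ ((IsCyclotomicExtension.zeta_spec 9 ℚ L).autToPow ℚ g : ZMod 9) ∈ ({1, 2, 4} : Finset (ZMod 9)))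
    (Φ : CMType L) (hΦ : ∀ g : L ≃ₐ[ℚ] L, ι.comp (g : L →+* L) ∈ D.cmType.1 ↔ ι.comp (g.symm : L →+* L) ∈ Φ.1) :
    ι ∈ Φ.1 :=
  IdeleClassGroup.self_mem_of_display_hmu_nine L ι Φ ((D.display_hmu_nine_iff ι hD Φ).1 hΦ)

/-- … and `Φ ≠ Φ_μ`: `ι ∘ σ₂ ∈ (D …).cmType` but `ι ∘ σ₂ ∉ Φ` — the toy SEPARATES the displays' pairing «`Φ_μ = Φ*`» from «`Φ_μ = Φ`».
[cite: Shimura1998, §8.4 Example (1)] -/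
theorem Thm418Data.exists_mem_cmType_not_mem_of_display_hmu_nine (ι : L →+* ℂ)
    (hD : ∀ g : L ≃ₐ[ℚ] L,
      ι.comp (g : L →+* L) ∈ D.cmType.1 ↔ ((IsCyclotomicExtension.zeta_spec 9 ℚ L).autToPow ℚ g : ZMod 9) ∈ ({1, 2, 4} : Finset (ZMod 9)))
    (Φ : CMType L) (hΦ : ∀ g : L ≃ₐ[ℚ] L, ι.comp (g : L →+* L) ∈ D.cmType.1 ↔ ι.comp (g.symm : L →+* L) ∈ Φ.1) :
    ∃ g : L ≃ₐ[ℚ] L, ι.comp (g : L →+* L) ∈ D.cmType.1 ∧ ι.comp (g : L →+* L) ∉ Φ.1 := by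
  rw [D.cmType_eq_cmType] at hD hΦ ⊢
  exact IdeleClassGroup.exists_mem_cmType_not_mem_of_display_hmu_nine L ι D.isConjugateSymplectic hD Φ hΦ

/-! ## §3 Non-vacuity at the datum type -/

/-- **There IS such a datum over `ℚ(ζ₉)`**: for every `ι`, a `D : Thm418Data L⁺ L` with `Φ_μ ↔ {1,2,4}` through `ι` — REAL fields a
weight-one conjugate symplectic `μ` with that CM type (tree `exists_weightOne_cmType_nine`), carriers trivial (as in `Thm418Data.nonempty`).
[cite: WeilBNT1967, Ch. VII §3] -/
theorem Thm418Data.exists_cmType_nine (ι : L →+* ℂ) :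
    ∃ D : Thm418Data (maximalRealSubfield L) L, ∀ g : L ≃ₐ[ℚ] L,
      ι.comp (g : L →+* L) ∈ D.cmType.1 ↔ ((IsCyclotomicExtension.zeta_spec 9 ℚ L).autToPow ℚ g : ZMod 9) ∈ ({1, 2, 4} : Finset (ZMod 9)) := by
  haveI : IsGalois ℚ L := isGalois_nine L
  obtain ⟨μ, hμ, hw, hΦ⟩ := IdeleClassGroup.exists_weightOne_cmType_nine L ι
  exact ⟨⟨2, le_rfl, PUnit, PUnit, PUnit, fun _ => PUnit.unit, PUnit, μ, hμ, hw, PUnit, fun _ _ => PUnit, fun _ _ => 1, PUnit, 1,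
    fun _ _ => PUnit, fun _ _ => 0⟩, hΦ⟩

end Nine

/-! ## §4 The hypotheses on `L` are met by Mathlib's `ℚ(ζ₉)` -/

/-- `CyclotomicField 9 ℚ = ℚ(ζ₉)` is a 9th cyclotomic extension of `ℚ` (Mathlib's instance, not found by instance search at the numeral).
[cite: Washington1997, Thm. 2.5] -/
theorem isCyclotomicExtension_cyclotomicField_nine : IsCyclotomicExtension {9} ℚ (CyclotomicField.{0} 9 ℚ) :=
  CyclotomicField.instIsCyclotomicExtensionSingletonNatSetOfCharZero 9 ℚ

/-- `ℚ(ζ₉)` is a CM field (Mathlib `IsCyclotomicExtension.Rat.isCMField`; Shimura's Example (1): cyclotomic fields). [cite: Shimura1998, §8.4 Example (1)] -/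
theorem isCMField_cyclotomicField_nine : IsCMField (CyclotomicField.{0} 9 ℚ) :=
  @IsCyclotomicExtension.Rat.isCMField _ _ _ {9} ⟨9, rfl, by norm_num⟩ isCyclotomicExtension_cyclotomicField_nine

end Literature.NumberTheory.Automorphic.Liu2021
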